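import Mathlib
import Summits.HodgeConjecture.FermatCycles.HodgeFermatHypUTailQB

/-!
# HypUTailOdd — the tail of LEMMA S at ALL odd squarefree levels, part 1 (`HodgeFermat/HypUTailOdd.lean`; HF-G25)

Tree copy (part 1 of 2) of the module `HodgeFermat/HypUTailOdd.lean` of the sibling cell's standalone package
`run/shared/lean/pub/pub-hodgefermat/lean/HodgeFermat/` (488 lines, sha256 `cc21e8ab7ebf622d…`), source lines 32–221 (§§1–3: the prime staircase from 3, the bands `XK`, `Dmin`, `bnd`, `bnd_lt_one`).
Filed by cell `pub-hfermat`, seat prover-1 gen-3, on the COORDINATOR KEEPER RULING of 2026-08-25 (gem sweep H1: take the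
off-gate kernel theorem `thmFstar` through the gate) — here THEOREM F* of `tables/DPRIME-THEOREM.md` §9 IN FULL, i.e.
PROPOSITION D′(3N) and the descent (`HodgeFermat/PropDPrimeNFinal.lean`, GATE HF-G34), the last off-gate form of THEOREM F*
(its first two forms, `DecodingFinal.thmFstar` = F* at the prime levels and `ThmFstarNFinal.thmFstar` = F*(3N), landed on
2026-08-25 as `HodgeFermatThmFstar.lean` / `HodgeFermatThmFstarN.lean`, seats prover-1 gen-0 / gen-2); this file is one link of
the import closure of `PropDPrimeNFinal.propDprime` (the sibling's KR-free chain: THEOREM L, COROLLARY M, THEOREM D6,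
THEOREM U⁺, THEOREM KR6, THEOREM Z3U) on top of those landed chains.  The source module is the sibling's hub-checked module of
record (pub-hodgefermat `CERT.md` l.906, GATE HF-G25; cell record `check/HypUTailOdd_standalone.lean` sha256 `2946650e39e5a462…`); its declarations are copied VERBATIM.
Deviations from the source module, exhaustively: the `import` lines (tree modules `Summits.HodgeConjecture.FermatCycles.
HodgeFermat*` instead of `HodgeFermat.*`); this module docstring; QUALIFIED-NAME SUBSTITUTIONS (name resolution only, forced by the DEDUP deletions in `HodgeFermatHypUTailQA/B.lean`): the source's references to the deleted restated copies `HypUTailQ.le_foldr_min` (l.134), `HypUTailQ.foldr_min_le_mem` (l.184), `HypUTailQ.sum_range_eq_list` (l.215), `HypUTailQ.log_le_orderOf` (l.421), `HypUTailQ.list_sum_map_range` (l.469) now name the landed twins `HypVTail.…` (same statements), and `HypUTailQ.harmonic_cast_le` (l.238, 252) names `Literature.NumberTheory.LFunctions.VKZeta.sum_range_inv_succ_le'`; nothing else in those lines changes; one-line docstrings added (gate lint) to `qt_ge`, `qt_odd`, `qt_zero`, `XK_le`, `bnd_cast`; the file ends at source l.221 with an `end` line (part 2 = `HodgeFermatH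ypUTailOddB.lean`).
Every other line — in particular every declaration's statement and proof — is byte-identical to the source.
HONEST FRAMING: explicit algebraic cycles for specific Hodge classes on Fermat/Delsarte varieties; residual open instances
listed; no claim on general Hodge.  (This file is arithmetic of CM types / finite combinatorics / analytic number theory
of the sibling's KR-free programme; it claims nothing about cycles.)

The source module's docstring (HypUTailOdd.lean l.6–30), verbatim:

## HypUTailOdd — the tail of LEMMA S at ALL odd squarefree levels (generation 25, HF-G25)

`goodTail : Squarefree N → ¬ 2 ∣ N → XK (#primeFactors N) < N → 6 * ∑ p ∈ N.primeFactors, tau N p < φ(N)`: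
the level inequality of HYPOTHESIS U (`= LEMMA S` of `tables/SEMI-THEOREM.md` §2) at every odd
squarefree level beyond a threshold `XK k` depending only on the number `k` of prime factors
(`XK = 100, 700, 5000, 20000, 100000` for `k ≤ 1, = 2, 3, 4, 5` and `XK = 0` for `k ≥ 6`), the prime `3`
now being ALLOWED to divide `N` (generation 24's `HypUTailQ.uTail` assumed `N` prime to `6`).

The argument is that of `HypUTailQ.lean` with three changes.
* The `i`-th smallest prime factor of an odd `N` is at least the `i`-th odd prime `qt i = 3, 5, 7, 11, …`
  (table to `97`, then `2 i + 3`; `qt_step` by a kernel check of the table gaps).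
* SIZE: `N ≥ L k := max (XK k) (min (Q k) 10⁷)` where `Q k = ∏_{i<k} qt i ≤ N` — for `k ≥ 6` the
  product of the six smallest odd primes `255255` already exceeds every threshold needed, so no
  hypothesis on the size of `N` remains (`XK k = 0`).
* BANDS, generically: `ord_{N/p}(p) ≥ max (⌊log_p (L k)⌋, #{q ∣ N : q ≥ p})`, and for odd `p ≥ q ≥ 3`,
  `(p - 1) · max (⌊log_p L⌋, m) ≥ Dmin L ss q m`, the minimum of `(c - 1) · max (⌊log_c L⌋, m)` over
  `c = q` and the ODD BAND STARTS `c ∈ ss`, `c > q` (`den_ge`) — valid for ANY list `ss` passing the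
  decidable test `bandOK L ss` (for every exponent `e < ⌊log_3 L⌋` the list contains the least odd
  `s ≥ 3` with `s^(e+1) > L`); the eight lists used (`starts k`) are checked by `decide +kernel`
  (`bands_ok`), as is the rational table `bnd k < 1` for `0 < k < 25` (`bnd_lt_one`; maximum
  `7373/7392 = 0.99743` at `k = 6`, then `277/280` at `k = 5`); for `k ≥ 25` partial fractions and
  `H_n ≤ 1 + log n` as before (`(p_i - 1) d_i ≥ (2 i + 2)(k - i)`).
Data and the exact table: `code/gen25/mk_tailodd.py` (mirrors these definitions; asserts the same facts).
-/

set_option autoImplicit false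

namespace HodgeFermat.KRFree.HypUOdd

open Finset HodgeFermat.KRFree.HypBReduction

/-! ## §1 The odd-prime table -/

/-- the odd primes below `100`. -/
def qtab : List ℕ :=
  [3, 5, 7, 11, 13, 17, 19, 23, 29, 31, 37, 41, 43, 47, 53, 59, 61, 67, 71, 73, 79, 83, 89, 97]

/-- lower bound for the `i`-th smallest prime factor (from `0`) of an odd number:
the `i`-th odd prime for `i ≤ 23`, `2 i + 3` beyond. -/
def qt (i : ℕ) : ℕ := qtab.getD i (2 * i + 3)

/-- `qt i ≥ 2i + 3` -/
theorem qt_ge (i : ℕ) : 2 * i + 3 ≤ qt i := by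
  by_cases hi : i < 24
  · unfold qt qtab; interval_cases i <;> decide
  · unfold qt
    rw [List.getD_eq_default _ _ (by unfold qtab; simp; omega)]

/-- every `qt i` is odd -/
theorem qt_odd (i : ℕ) : qt i % 2 = 1 := by
  by_cases hi : i < 24
  · unfold qt qtab; interval_cases i <;> decide
  · unfold qt
    rw [List.getD_eq_default _ _ (by unfold qtab; simp; omega)]
    omega

/-- `qt 0 = 3` -/
theorem qt_zero : qt 0 = 3 := by decide

/-- kernel check: every number strictly inside a gap of the table has a divisor among `2, 3, 5, 7`
smaller than itself. -/
theorem qtab_gaps : ∀ i, i < 23 → ∀ s, s < 98 → qt i < s → s < qt (i + 1) →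
    [2, 3, 5, 7].any (fun d => Nat.blt d s && (s % d == 0)) = true := by
  decide +kernel

/-- the table step: an odd prime above the `i`-th bound is at least the `(i+1)`-st bound. -/
theorem qt_step (i r s : ℕ) (hr : qt i ≤ r) (hrs : r < s) (hro : r % 2 = 1) (hso : s % 2 = 1)
    (hs : s.Prime) : qt (i + 1) ≤ s := by
  by_cases hi : i < 23
  · by_contra hlt
    push Not at hlt
    have hq1 : qt (i + 1) ≤ 97 := by
      unfold qt qtab; interval_cases i <;> decide
    have hgap := qtab_gaps i hi s (by omega) (by omega) hlt
    simp only [List.any_cons, List.any_nil, Bool.or_false, Bool.or_eq_true, Bool.and_eq_true,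
      Nat.blt_eq, beq_iff_eq] at hgap
    have key : ∀ d, d < s → s % d = 0 → 2 ≤ d → False := by
      intro d hds hmod hd2
      have hdvd : d ∣ s := Nat.dvd_of_mod_eq_zero hmod
      rcases (Nat.dvd_prime hs).mp hdvd with h | h <;> omega
    rcases hgap with ⟨h1, h2⟩ | ⟨h1, h2⟩ | ⟨h1, h2⟩ | ⟨h1, h2⟩
    · exact key 2 h1 h2 le_rfl
    · exact key 3 h1 h2 (by omega)
    · exact key 5 h1 h2 (by omega)
    · exact key 7 h1 h2 (by omega)
  · have h1 : qt (i + 1) = 2 * (i + 1) + 3 := by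
      unfold qt
      rw [List.getD_eq_default _ _ (by unfold qtab; simp; omega)]
    have h2 := qt_ge i
    omega

/-! ## §2 Thresholds and the size bound -/

/-- the walk threshold for `k` prime factors: the level inequality is certified by the kernel walk of
`HypUWalk3.lean` for `N ≤ XK k` and by `goodTail` beyond. -/
def XK (k : ℕ) : ℕ :=
  if k ≤ 1 then 100 else if k = 2 then 700 else if k = 3 then 5000 else if k = 4 then 20000
  else if k = 5 then 100000 else 0

/-- the band ends `XK k` are at most `100000` -/
theorem XK_le (k : ℕ) : XK k ≤ 100000 := by
  unfold XK; split_ifs <;> omega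

/-- cap of the size bound (keeps the kernel arithmetic below `10⁷`). -/
def C : ℕ := 10000000

/-- `Q k = qt 0 · qt 1 ⋯ qt (k-1) ≤ N` for an odd squarefree `N` with `k` prime factors. -/
def Q (k : ℕ) : ℕ := ((List.range k).map qt).prod

/-- the size lower bound used in the exponent floors: `N ≥ L k`. -/
def L (k : ℕ) : ℕ := max (XK k) (min (Q k) C)

/-! ## §3 Generic band minima -/

/-- value of the candidate `c`: `(c - 1) · max (⌊log_c L⌋, m)`. -/
def cval (Lv m c : ℕ) : ℕ := (c - 1) * max (Nat.log c Lv) m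

/-- the band minimum: over `c = q` and the candidates `c ∈ ss` above `q`. -/
def Dmin (Lv : ℕ) (ss : List ℕ) (q m : ℕ) : ℕ :=
  ((ss.filter (fun c => q < c)).map (cval Lv m)).foldr min (cval Lv m q)

/-- the decidable test on a candidate list: for every exponent `e < ⌊log_3 L⌋` it contains an odd
`s ≥ 3` with `s^(e+1) > L` which is the LEAST such (`s = 3` or `(s-2)^(e+1) ≤ L`). -/
def bandOK (Lv : ℕ) (ss : List ℕ) : Bool :=
  (List.range (Nat.log 3 Lv)).all (fun e => ss.any (fun s =>
    (s % 2 == 1) && Nat.ble 3 s && Nat.blt Lv (s ^ (e + 1)) &&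
      (Nat.ble s 3 || Nat.ble ((s - 2) ^ (e + 1)) Lv)))

/-- every candidate is `≥ q`, so `Dmin ≥ (q - 1) m`. -/
theorem Dmin_ge (Lv : ℕ) (ss : List ℕ) (q m : ℕ) : (q - 1) * m ≤ Dmin Lv ss q m := by
  unfold Dmin
  apply HypVTail.le_foldr_min
  · unfold cval; exact Nat.mul_le_mul le_rfl (le_max_right _ _)
  · intro x hx
    simp only [List.mem_map, List.mem_filter, decide_eq_true_eq] at hx
    obtain ⟨c, ⟨-, hqc⟩, rfl⟩ := hx
    unfold cval
    exact Nat.mul_le_mul (by omega) (le_max_right _ _)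

/-- MAIN BOUND ON ONE TERM (generic): for odd `p ≥ q ≥ 3` and any candidate list passing `bandOK`,
`(p - 1) · max (⌊log_p L⌋, m) ≥ Dmin L ss q m`. -/
theorem den_ge (Lv : ℕ) (ss : List ℕ) (hok : bandOK Lv ss = true) (q m p : ℕ) (hq : 3 ≤ q)
    (hqo : q % 2 = 1) (hpo : p % 2 = 1) (hqp : q ≤ p) :
    Dmin Lv ss q m ≤ (p - 1) * max (Nat.log p Lv) m := by
  have hEpq : Nat.log p Lv ≤ Nat.log q Lv := Nat.log_anti_left (by omega) hqp
  rcases Nat.eq_or_lt_of_le hEpq with heq | hlt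
  · calc Dmin Lv ss q m ≤ cval Lv m q := HypUTailQ.foldr_min_le_init _ _
      _ = (q - 1) * max (Nat.log p Lv) m := by rw [cval, heq]
      _ ≤ (p - 1) * max (Nat.log p Lv) m := Nat.mul_le_mul (by omega) le_rfl
  · have hE3 : Nat.log q Lv ≤ Nat.log 3 Lv := Nat.log_anti_left (by norm_num) hq
    have he3 : Nat.log p Lv < Nat.log 3 Lv := lt_of_lt_of_le hlt hE3
    have hok' : ∀ e, e < Nat.log 3 Lv → ∃ s ∈ ss, ((s % 2 = 1 ∧ 3 ≤ s) ∧ Lv < s ^ (e + 1)) ∧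
        (s ≤ 3 ∨ (s - 2) ^ (e + 1) ≤ Lv) := by
      intro e he
      have h := hok
      simp only [bandOK, List.all_eq_true, List.mem_range] at h
      have h' := h e he
      simpa [List.any_eq_true, Bool.and_eq_true, Bool.or_eq_true, beq_iff_eq, Nat.ble_eq,
        Nat.blt_eq] using h'
    obtain ⟨s, hsmem, ⟨⟨hso, hs3⟩, hpow⟩, hmin⟩ := hok' _ he3
    have hEs_le : Nat.log s Lv ≤ Nat.log p Lv := by
      have := Nat.log_lt_of_lt_pow' (by omega) hpow
      omega
    have hqs : q < s := by
      by_contra h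
      push Not at h
      have : Nat.log q Lv ≤ Nat.log s Lv := Nat.log_anti_left (by omega : 1 < s) h
      omega
    have hsp : s ≤ p := by
      rcases hmin with hs3' | hmin
      · omega
      · by_contra h
        push Not at h
        have hps2 : p ≤ s - 2 := by omega
        have h1 : Nat.log p Lv + 1 ≤ Nat.log (s - 2) Lv := Nat.le_log_of_pow_le (by omega) hmin
        have h2 : Nat.log (s - 2) Lv ≤ Nat.log p Lv := Nat.log_anti_left (by omega) hps2
        omega
    have hEs : Nat.log s Lv = Nat.log p Lv :=
      le_antisymm hEs_le (Nat.log_anti_left (by omega) hsp)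
    have hmem : cval Lv m s ∈ (ss.filter (fun c => q < c)).map (cval Lv m) :=
      List.mem_map.mpr ⟨s, List.mem_filter.mpr ⟨hsmem, by simpa using hqs⟩, rfl⟩
    calc Dmin Lv ss q m ≤ cval Lv m s := HypVTail.foldr_min_le_mem _ _ hmem
      _ = (s - 1) * max (Nat.log p Lv) m := by rw [cval, hEs]
      _ ≤ (p - 1) * max (Nat.log p Lv) m := Nat.mul_le_mul (by omega) le_rfl

/-! ## §4 The band starts (data) and the finite table -/

/-- the odd band starts of `L k` (least odd `s ≥ 3` with `s^(e+1) > L k`, `e < ⌊log_3 (L k)⌋`);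
generated by `code/gen25/mk_tailodd.py`, certified by `bands_ok`. -/
def starts (k : ℕ) : List ℕ :=
  match k with
  | 0 | 1 => [5, 11, 101]
  | 2 => [5, 7, 9, 27, 701]
  | 3 => [5, 7, 9, 19, 71, 5001]
  | 4 => [5, 7, 9, 13, 29, 143, 20001]
  | 5 => [5, 7, 11, 19, 47, 317, 100001]
  | 6 => [5, 7, 9, 13, 23, 65, 507, 255257]
  | 7 => [5, 7, 11, 15, 23, 47, 171, 2203, 4849847]
  | _ => [5, 7, 9, 11, 15, 27, 57, 217, 3163, 10000001]

/-- DATA CHECK (kernel): the eight candidate lists pass `bandOK` at their size bounds. -/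
theorem bands_ok : ∀ k, k < 25 → bandOK (L k) (starts k) = true := by decide +kernel

/-- the rational table `∑_{i<k} 6 / Dmin (L k) (starts k) (qt i) (k - i)`. -/
def bnd (k : ℕ) : ℚ :=
  ((List.range k).map (fun i => (6 : ℚ) / Dmin (L k) (starts k) (qt i) (k - i))).sum

/-- FINITE TABLE (kernel evaluation): `bnd k < 1` for `0 < k < 25` (maximum `7373/7392` at `k = 6`). -/
theorem bnd_lt_one : ∀ k, k < 25 → 0 < k → bnd k < 1 := by decide +kernel

/-- `bnd k` cast to `ℝ` as the sum `Σ_{i<k} 6 / Dmin` -/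
theorem bnd_cast (k : ℕ) :
    (bnd k : ℝ) = ∑ i ∈ range k, (6 : ℝ) / (Dmin (L k) (starts k) (qt i) (k - i) : ℝ) := by
  rw [HypVTail.sum_range_eq_list, bnd]
  induction (List.range k) with
  | nil => simp
  | cons x l ih =>
      simp only [List.map_cons, List.sum_cons, Rat.cast_add] at *
      rw [ih]; push_cast; ring


end HodgeFermat.KRFree.HypUOdd
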